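import Summits.NavierStokesRegularity.NavierStokesRegularity.Theorems.ExtremiserTransienceTwoThirdsGauge
import Summits.NavierStokesRegularity.NavierStokesRegularity.Theorems.ExtremiserTransienceTwoThirdsGaugeSup
import Summits.NavierStokesRegularity.NavierStokesRegularity.Theorems.ExtremiserTransienceTwoThirdsGaugeFar
import Summits.NavierStokesRegularity.NavierStokesRegularity.Theorems.ExtremiserTransienceLocalMaximiserLimitDefs
import Literature.Analysis.FluidPDE.BallCutoff
import HarnessLib

/-!
# Route `ExtremiserTransience`, crux `NearExtremalTransiencePerFlow` (stmt-NavierStokesRegularity-26567), LINE g10-1 «two_thirds»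
# (ns-idea-10 g10), stub S2 `FirstOrderIdentity`: the TRUNCATED BIOT–SAVART GAUGE of the limit field — pointwise facts

Helper file for S2 (`--supports stmt-NavierStokesRegularity-26567`).  For a smooth divergence-free field `V` with `‖V‖ ≤ 1` and linear
energy growth `∫_{B(x,r)} ‖V‖² ≤ A_E r` (the limit class), a centre `c` and a radius `R ≥ 1`, the gauge of S2 is

  `ψ := K ∗ h`,  `h := ζ·V`,  `ζ := ballCutoff c R` (`= 1` on `B̄(c,2R)`, `= 0` off `B(c,3R)`, `‖Dζ‖ ≤ C₀/R`),

and the REMAINDER is `G := V − curl ψ = (1 − ζ)V + ∇q`, `q = Γ ∗ div h`, `div h = Dζ(V)` supported in `2R ≤ ‖y − c‖ ≤ 3R`.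
This file proves the pointwise half of the «gauge package»:

* `truncation_facts` — smoothness, support, size of `h = ζV` and of its divergence `Dζ(V)`;
* `integral_abs_div_truncation_le` — `∫ |div h| ≤ 8C₀(A_E + 4π/3)·R` (AM–GM on `B(c,4R)`, `…TwoThirdsGaugeSup`);
* `gauge_pointwise` — `ψ` smooth; `G` smooth; `curl G = 0` on `B(c,2R)`; for `x ∈ B(c,3R/2)` (distance `≥ R/2` from the support of
  `div h`): `‖G(x)‖ ≤ C/R`, `‖DG(x)‖ ≤ C/R²` (`…TwoThirdsGaugeFar`); and for `x ∈ B(c,2R)`, `5R ≤ 2^{K+1}`: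
  `‖ψ(x)‖ ≤ 1 + (K+1)(A_E + 4π/3)/(2π)` (`…TwoThirdsGaugeSup`).

HONEST FRAMING: potential theory on `ℝ³`; nothing about Navier–Stokes regularity or blow-up is proved; S2, the crux ⟨26567⟩ and NS
regularity are OPEN; no summit is proved by a line. [folklore]
-/

noncomputable section

open scoped Topology InnerProductSpace RealInnerProductSpace ENNReal ContDiff
open MeasureTheory Filter Set Metric
open Literature.Analysis.FluidPDE
open Summit.NavierStokesRegularity.NavierStokesRegularity.Theorems.DepletionLadder.KStar.HalfSpace
open Summit.NavierStokesRegularity.NavierStokesRegularity.Theorems.NearExtremalTransiencePerFlow.LocalMaximiser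

namespace Summit.NavierStokesRegularity.NavierStokesRegularity.Theorems.NearExtremalTransiencePerFlow.TwoThirds

-- the summit's namespace repeats the problem name by convention (D-0017)
set_option linter.dupNamespace false

variable {V : E3 → E3} {A_E : ℝ} {c : E3} {R : ℝ}

/-- `‖∇φ(x)‖ = ‖Dφ(x)‖` (Riesz isometry). [folklore] -/
theorem norm_gradient_eq_norm_fderiv (φ : E3 → ℝ) (x : E3) : ‖gradient φ x‖ = ‖fderiv ℝ φ x‖ := by
  rw [gradient, LinearIsometryEquiv.norm_map]

/-- `‖D(∇φ)(x)‖ ≤ ‖D²φ(x)‖` (the gradient is an isometric image of the derivative). [folklore] -/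
theorem norm_fderiv_gradient_le' {φ : E3 → ℝ} (x : E3) : ‖fderiv ℝ (gradient φ) x‖ ≤ ‖fderiv ℝ (fderiv ℝ φ) x‖ := by
  have hgrad : gradient φ = (InnerProductSpace.toDual ℝ E3).symm ∘ (fderiv ℝ φ) := by
    funext z; rfl
  rw [hgrad, LinearIsometryEquiv.comp_fderiv]
  refine ContinuousLinearMap.opNorm_le_bound _ (norm_nonneg (fderiv ℝ (fderiv ℝ φ) x)) fun v => ?_
  rw [ContinuousLinearMap.comp_apply]
  calc ‖((InnerProductSpace.toDual ℝ E3).symm : StrongDual ℝ E3 →L[ℝ] E3) (fderiv ℝ (fderiv ℝ φ) x v)‖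
      = ‖fderiv ℝ (fderiv ℝ φ) x v‖ := LinearIsometryEquiv.norm_map _ _
    _ ≤ ‖fderiv ℝ (fderiv ℝ φ) x‖ * ‖v‖ := ContinuousLinearMap.le_opNorm _ _

/-- `‖D²q(x)‖ ≤ M` from the entrywise bounds `|∂_b∂_a q(x)| ≤ M‖a‖‖b‖` (for `Dq` differentiable at `x`). [folklore] -/
theorem norm_fderiv_fderiv_le_of_apply {q : E3 → ℝ} {x : E3} (hq : DifferentiableAt ℝ (fderiv ℝ q) x) {M : ℝ} (hM : 0 ≤ M)
    (h : ∀ a b : E3, |fderiv ℝ (fun x' => fderiv ℝ q x' a) x b| ≤ M * ‖a‖ * ‖b‖) :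
    ‖fderiv ℝ (fderiv ℝ q) x‖ ≤ M := by
  refine ContinuousLinearMap.opNorm_le_bound _ hM fun b => ?_
  refine ContinuousLinearMap.opNorm_le_bound _ (by positivity) fun a => ?_
  have e : fderiv ℝ (fderiv ℝ q) x b a = fderiv ℝ (fun x' => fderiv ℝ q x' a) x b := by
    rw [fderiv_clm_apply hq (differentiableAt_const a)]
    simp
  rw [e, Real.norm_eq_abs]
  calc |fderiv ℝ (fun x' => fderiv ℝ q x' a) x b| ≤ M * ‖a‖ * ‖b‖ := h a b
    _ = M * ‖b‖ * ‖a‖ := by ring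

/-! ## The truncation `h = ζV` and its divergence -/

/-- **The truncation and its divergence.**  With `ζ = ballCutoff c R` (`R > 0`), `h = ζV`, `g = Dζ(V)`: `h` is smooth with compact
support in `B̄(c,3R)`, `‖h‖ ≤ 1`, `‖h‖ ≤ ‖V‖`, `h = V` near every point of `B(c,2R)`; `div h = g`, `g` is smooth with compact support,
`|g| ≤ (C₀/R)‖V‖`, and `g(y) ≠ 0 ⇒ 2R ≤ ‖y − c‖ ≤ 3R`. [folklore] -/
theorem truncation_facts (hVs : ContDiff ℝ (⊤ : ℕ∞) V) (hdiv : VectorCalculus.IsDivFree V) (hV1 : ∀ x, ‖V x‖ ≤ 1) (hR : 0 < R)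
    {C₀ : ℝ} (hC₀ : ∀ y, ‖fderiv ℝ (ballCutoff c R) y‖ ≤ C₀ / R) :
    ContDiff ℝ (⊤ : ℕ∞) (fun y => ballCutoff c R y • V y) ∧ HasCompactSupport (fun y => ballCutoff c R y • V y) ∧
    (∀ y, ‖ballCutoff c R y • V y‖ ≤ 1) ∧ (∀ y, ‖ballCutoff c R y • V y‖ ≤ ‖V y‖) ∧
    (∀ y ∈ ball c (2 * R), (fun y => ballCutoff c R y • V y) =ᶠ[𝓝 y] V) ∧
    (∀ y, ballCutoff c R y • V y ≠ 0 → ‖y - c‖ < 3 * R) ∧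
    VectorCalculus.divergence (fun y => ballCutoff c R y • V y) = (fun y => fderiv ℝ (ballCutoff c R) y (V y)) ∧
    ContDiff ℝ (⊤ : ℕ∞) (fun y => fderiv ℝ (ballCutoff c R) y (V y)) ∧
    HasCompactSupport (fun y => fderiv ℝ (ballCutoff c R) y (V y)) ∧
    (∀ y, |fderiv ℝ (ballCutoff c R) y (V y)| ≤ C₀ / R * ‖V y‖) ∧
    (∀ y, fderiv ℝ (ballCutoff c R) y (V y) ≠ 0 → 2 * R ≤ ‖y - c‖ ∧ ‖y - c‖ < 3 * R) := by
  set ζ := ballCutoff c R with hζ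
  have hζs : ContDiff ℝ (⊤ : ℕ∞) ζ := contDiff_ballCutoff c R
  have hζd : Differentiable ℝ ζ := hζs.differentiable (by simp)
  have hVd : Differentiable ℝ V := hVs.differentiable (by simp)
  have hζc : HasCompactSupport ζ := hasCompactSupport_ballCutoff hR
  have hh : ContDiff ℝ (⊤ : ℕ∞) fun y => ζ y • V y := hζs.smul hVs
  have hhc : HasCompactSupport fun y => ζ y • V y := hζc.smul_right
  have h01 : ∀ y, 0 ≤ ζ y ∧ ζ y ≤ 1 := fun y => ⟨ballCutoff_nonneg c R y, ballCutoff_le_one c R y⟩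
  have hnorm : ∀ y, ‖ζ y • V y‖ ≤ ‖V y‖ := fun y => by
    rw [norm_smul, Real.norm_eq_abs, abs_of_nonneg (h01 y).1]
    exact mul_le_of_le_one_left (norm_nonneg _) (h01 y).2
  -- `Dζ = 0` on the open ball `B(c,2R)` and off `B̄(c,3R)`
  have hDζ_in : ∀ y ∈ ball c (2 * R), fderiv ℝ ζ y = 0 := fun y hy => by
    rw [(ballCutoff_eventuallyEq_one hR hy).fderiv_eq, fderiv_const_apply]
  have hDζ_out : ∀ y, y ∉ closedBall c (3 * R) → fderiv ℝ ζ y = 0 := fun y hy => by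
    rw [(ballCutoff_eventuallyEq_zero hR hy).fderiv_eq, fderiv_const_apply]
  refine ⟨hh, hhc, fun y => (hnorm y).trans (hV1 y), hnorm, fun y hy => ?_, fun y hy => ?_, ?_, ?_, ?_, fun y => ?_, fun y hy => ?_⟩
  · filter_upwards [ballCutoff_eventuallyEq_one hR hy] with z hz
    rw [show ζ z = 1 from hz, one_smul]
  · by_contra hlt
    push Not at hlt
    exact hy (by rw [hζ, ballCutoff_eq_zero hR hlt, zero_smul])
  · funext y
    exact divergence_smul_of_isDivFree (hζd y) (hVd y) (hdiv y)
  · exact ((contDiff_infty_iff_fderiv.1 hζs).2).clm_apply hVs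
  · refine (hζc.fderiv (𝕜 := ℝ)).mono fun y hy => ?_
    rw [Function.mem_support] at hy ⊢
    intro h0
    exact hy (by rw [h0, zero_apply])
  · rw [← Real.norm_eq_abs]
    exact (ContinuousLinearMap.le_opNorm _ _).trans (mul_le_mul_of_nonneg_right (hC₀ y) (norm_nonneg _))
  · constructor
    · by_contra hlt
      push Not at hlt
      exact hy (by rw [hDζ_in y (by rwa [mem_ball, dist_eq_norm]), zero_apply])
    · by_contra hge
      push Not at hge
      have hy' : y ∉ closedBall c (3 * R) ∨ ‖y - c‖ = 3 * R := by
        rcases hge.lt_or_eq with h | h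
        · exact Or.inl (by rw [mem_closedBall, dist_eq_norm, not_le]; exact h)
        · exact Or.inr h.symm
      rcases hy' with h | h
      · exact hy (by rw [hDζ_out y h, zero_apply])
      · -- on the sphere `‖y − c‖ = 3R` the cutoff has a local minimum (value `0`), so `Dζ = 0` there too
        have hmin : IsLocalMin ζ y := by
          filter_upwards with z
          rw [hζ, ballCutoff_eq_zero hR (le_of_eq h.symm)]
          exact ballCutoff_nonneg c R z
        exact hy (by rw [hmin.fderiv_eq_zero, zero_apply])

/-- **`∫ |div h| ≤ 8C₀(A_E + 4π/3)·R`** under linear growth (AM–GM on the ball `B(c,4R)`). [folklore] -/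
theorem integral_abs_div_truncation_le (hVs : ContDiff ℝ (⊤ : ℕ∞) V) (hdiv : VectorCalculus.IsDivFree V) (hV1 : ∀ x, ‖V x‖ ≤ 1)
    (hgr : HasLinearGrowth A_E V) (hR : 0 < R) {C₀ : ℝ} (hC₀0 : 0 ≤ C₀) (hC₀ : ∀ y, ‖fderiv ℝ (ballCutoff c R) y‖ ≤ C₀ / R) :
    ∫ y, |fderiv ℝ (ballCutoff c R) y (V y)| ≤ 8 * C₀ * (A_E + 4 * Real.pi / 3) * R := by
  obtain ⟨-, -, -, -, -, -, -, hgs, hgc, hgle, hgsupp⟩ := truncation_facts (c := c) hVs hdiv hV1 hR hC₀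
  set g : E3 → ℝ := fun y => fderiv ℝ (ballCutoff c R) y (V y) with hg
  -- `|g| ≤ (C₀/R) · 1_{B(c,4R)} ‖V‖`
  have hmaj : ∀ y, |g y| ≤ C₀ / R * (ball c (4 * R)).indicator (fun y => ‖V y‖) y := by
    intro y
    by_cases hy : g y = 0
    · rw [hy, abs_zero]
      exact mul_nonneg (div_nonneg hC₀0 hR.le) (Set.indicator_nonneg (fun _ _ => norm_nonneg _) _)
    · have hmem : y ∈ ball c (4 * R) := by
        rw [mem_ball, dist_eq_norm]; linarith [(hgsupp y hy).2]
      rw [indicator_of_mem hmem]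
      exact hgle y
  have hint : Integrable fun y => C₀ / R * (ball c (4 * R)).indicator (fun y => ‖V y‖) y := by
    refine Integrable.const_mul ?_ _
    rw [integrable_indicator_iff measurableSet_ball]
    exact (hVs.continuous.norm.continuousOn.integrableOn_compact (isCompact_closedBall c _)).mono_set ball_subset_closedBall
  calc ∫ y, |g y| ≤ ∫ y, C₀ / R * (ball c (4 * R)).indicator (fun y => ‖V y‖) y :=
        integral_mono_of_nonneg (Eventually.of_forall fun y => abs_nonneg _) hint (Eventually.of_forall hmaj)
    _ = C₀ / R * ∫ y in ball c (4 * R), ‖V y‖ := by rw [integral_const_mul, integral_indicator measurableSet_ball]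
    _ ≤ C₀ / R * ((4 * R) ^ 2 * (A_E + 4 * Real.pi / 3) / 2) :=
        mul_le_mul_of_nonneg_left (setIntegral_norm_le_of_ballEnergy hVs.continuous (by positivity) (hgr c (4 * R) (by positivity)))
          (div_nonneg hC₀0 hR.le)
    _ = 8 * C₀ * (A_E + 4 * Real.pi / 3) * R := by field_simp; ring

/-! ## The gauge and the remainder, pointwise -/

/-- **THE GAUGE PACKAGE, pointwise half** (see the module docstring).  `ψ = K ∗ (ζV)`, `G = V − curl ψ`. [folklore] -/
theorem gauge_pointwise (hVs : ContDiff ℝ (⊤ : ℕ∞) V) (hdiv : VectorCalculus.IsDivFree V) (hV1 : ∀ x, ‖V x‖ ≤ 1)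
    (hgr : HasLinearGrowth A_E V) (hAE : 0 ≤ A_E) (hR : 0 < R) {C₀ : ℝ} (hC₀0 : 0 ≤ C₀) (hC₀ : ∀ y, ‖fderiv ℝ (ballCutoff c R) y‖ ≤ C₀ / R) :
    ContDiff ℝ (⊤ : ℕ∞) (biotSavart fun y => ballCutoff c R y • V y) ∧
    ContDiff ℝ (⊤ : ℕ∞) (fun x => V x - curl (biotSavart fun y => ballCutoff c R y • V y) x) ∧
    (∀ x ∈ ball c (2 * R), curl (fun x => V x - curl (biotSavart fun y => ballCutoff c R y • V y) x) x = 0) ∧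
    (∀ x ∈ ball c (3 / 2 * R), ‖V x - curl (biotSavart fun y => ballCutoff c R y • V y) x‖ ≤
      (Real.pi * R ^ 2)⁻¹ * (8 * C₀ * (A_E + 4 * Real.pi / 3) * R)) ∧
    (∀ x ∈ ball c (3 / 2 * R), ‖fderiv ℝ (fun x => V x - curl (biotSavart fun y => ballCutoff c R y • V y) x) x‖ ≤
      8 / (Real.pi * R ^ 3) * (8 * C₀ * (A_E + 4 * Real.pi / 3) * R)) ∧
    (∀ (K : ℕ) (x : E3), x ∈ ball c (2 * R) → 5 * R ≤ (2 : ℝ) ^ (K + 1) →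
      ‖biotSavart (fun y => ballCutoff c R y • V y) x‖ ≤ 1 + (K + 1) * (A_E + 4 * Real.pi / 3) / (2 * Real.pi)) := by
  obtain ⟨hh, hhc, hh1, hhV, hheq, hhsupp, hdivh, hgs, hgc, hgle, hgsupp⟩ := truncation_facts (c := c) hVs hdiv hV1 hR hC₀
  have hI := integral_abs_div_truncation_le (c := c) hVs hdiv hV1 hgr hR hC₀0 hC₀
  set h : E3 → E3 := fun y => ballCutoff c R y • V y with hhdef
  set g : E3 → ℝ := fun y => fderiv ℝ (ballCutoff c R) y (V y) with hgdef
  set ψ := biotSavart h with hψdef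
  set q : E3 → ℝ := fun x => ∫ y, newtonKernel (x - y) * g y with hqdef
  set G : E3 → E3 := fun x => V x - curl ψ x with hGdef
  have hψs : ContDiff ℝ (⊤ : ℕ∞) ψ := (contDiff_biotSavart_test hh hhc).1
  have hGs : ContDiff ℝ (⊤ : ℕ∞) G := hVs.sub (contDiff_curl (n := ⊤) hψs)
  have hqs : ContDiff ℝ (⊤ : ℕ∞) q := contDiff_newtonPotential_of_test hgs hgc
  have hq2 : ContDiff ℝ 2 q := hqs.of_le (by norm_cast)
  -- `curl ψ = h − ∇q`, hence `G = (1 − ζ)V + ∇q`, and `G = ∇q` near every point of `B(c,2R)`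
  have hcurlψ : ∀ x, curl ψ x = h x - gradient q x := fun x => by
    rw [hψdef, curl_biotSavart_test hh hhc x, hdivh]
  have hGeq : ∀ x ∈ ball c (2 * R), G =ᶠ[𝓝 x] gradient q := by
    intro x hx
    filter_upwards [(hheq x hx).eventuallyEq_nhds, isOpen_ball.mem_nhds hx] with y hy hyB
    show V y - curl ψ y = gradient q y
    rw [hcurlψ y, hy.eq_of_nhds]
    abel
  -- far-field geometry: points of `B(c, 3R/2)` are at distance `≥ R/2` from the support of `g`
  have hfar : ∀ x ∈ ball c (3 / 2 * R), ∀ y, g y ≠ 0 → R / 2 ≤ ‖x - y‖ := by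
    intro x hx y hy
    have h1 := (hgsupp y hy).1
    rw [mem_ball, dist_eq_norm] at hx
    have h2 : ‖y - c‖ ≤ ‖y - x‖ + ‖x - c‖ := norm_sub_le_norm_sub_add_norm_sub y x c
    rw [norm_sub_rev y x] at h2
    linarith
  have hgcont : Continuous g := hgs.continuous
  have hd : 0 < R / 2 := by positivity
  refine ⟨hψs, hGs, fun x hx => ?_, fun x hx => ?_, fun x hx => ?_, fun K x hx hK => ?_⟩
  · -- curl free on `B(c,2R)`
    have e : curl G x = curl (gradient q) x := by simp only [curl, (hGeq x hx).fderiv_eq]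
    rw [e]
    exact curl_gradient_eq_zero_holds q hq2 x
  · -- `‖G(x)‖ = ‖∇q(x)‖ = ‖Dq(x)‖ ≤ (4π(R/2)²)⁻¹ ∫|g|`
    have hx2 : x ∈ ball c (2 * R) := by
      rw [mem_ball] at hx ⊢; linarith
    have e : G x = gradient q x := (hGeq x hx2).eq_of_nhds
    show ‖G x‖ ≤ _
    rw [e, norm_gradient_eq_norm_fderiv]
    refine (norm_fderiv_newtonPotential_le_far hgcont hgc hd (hfar x hx)).trans ?_
    rw [show (4 * Real.pi * (R / 2) ^ 2)⁻¹ = (Real.pi * R ^ 2)⁻¹ by ring_nf]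
    exact mul_le_mul_of_nonneg_left hI (by positivity)
  · -- `‖DG(x)‖ = ‖D∇q(x)‖ ≤ ‖D²q(x)‖ ≤ 8/(πR³) ∫|g|`
    have hx2 : x ∈ ball c (2 * R) := by
      rw [mem_ball] at hx ⊢; linarith
    have e : fderiv ℝ G x = fderiv ℝ (gradient q) x := (hGeq x hx2).fderiv_eq
    show ‖fderiv ℝ G x‖ ≤ _
    rw [e]
    refine (norm_fderiv_gradient_le' x).trans ?_
    have hDq : DifferentiableAt ℝ (fderiv ℝ q) x :=
      ((hq2.fderiv_right (m := 1) (by norm_num)).differentiable one_ne_zero).differentiableAt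
    refine norm_fderiv_fderiv_le_of_apply hDq (by positivity) fun a b => ?_
    have hab := (abs_fderiv_fderiv_newtonPotential_le_far hgcont hgc hd (hfar x hx) a b).2
    refine hab.trans ?_
    have e2 : ‖a‖ * ‖b‖ / (Real.pi * (R / 2) ^ 3) = 8 / (Real.pi * R ^ 3) * ‖a‖ * ‖b‖ := by
      field_simp; ring
    rw [e2]
    have h0 : 0 ≤ 8 / (Real.pi * R ^ 3) * ‖a‖ * ‖b‖ := by positivity
    calc 8 / (Real.pi * R ^ 3) * ‖a‖ * ‖b‖ * ∫ y, |g y| ≤ 8 / (Real.pi * R ^ 3) * ‖a‖ * ‖b‖ * (8 * C₀ * (A_E + 4 * Real.pi / 3) * R) :=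
          mul_le_mul_of_nonneg_left hI h0
      _ = 8 / (Real.pi * R ^ 3) * (8 * C₀ * (A_E + 4 * Real.pi / 3) * R) * ‖a‖ * ‖b‖ := by ring
  · -- the sup bound of the gauge
    refine norm_biotSavart_le_of_ballEnergy (K := K) hVs.continuous hh1 hhV (fun y hy => ?_) (fun r hr => hgr x r hr)
    have h3 := hhsupp y hy
    rw [mem_ball, dist_eq_norm] at hx
    calc dist y x = ‖y - x‖ := dist_eq_norm _ _
      _ ≤ ‖y - c‖ + ‖c - x‖ := norm_sub_le_norm_sub_add_norm_sub y c x
      _ < 3 * R + 2 * R := by rw [norm_sub_rev c x]; linarith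
      _ = 5 * R := by ring
      _ ≤ (2 : ℝ) ^ (K + 1) := hK

end Summit.NavierStokesRegularity.NavierStokesRegularity.Theorems.NearExtremalTransiencePerFlow.TwoThirds

end
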